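import Mathlib.Probability.Moments.SubGaussian
import Literature.MathematicalPhysics.QuantumFieldTheory.Balaban1983to89.B1Eq324SmallFieldLeaf

/-!
# `Balaban1983to89.B1Eq324FluctuationSubgaussian` — T. Bałaban, *(Higgs)₂,₃ quantum fields in a finite volume. I. A lower bound*,
Commun. Math. Phys. **85** (1982) 603–626 [Balaban1982Higgs1], (3.24) p. 616 / p. 617: **THE GAUSSIAN FLUCTUATION VARIABLES OF THE
TREE ARE SUB-GAUSSIAN IN MATHLIB'S SENSE** — the hypothesis `ProbabilityTheory.HasSubgaussianMGF (X i j) c μ` of r14's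
`B1Eq324GaussianMomentLeaf` (the moment input of leaf (b) of the cumulant expansion) DISCHARGED for the bond variables `A′_b` under
`dμ_{C^{(j),L^jε}}` and the components `φ′(y)_i` under `dμ_{C^{(k)}_Λ(Ω,A)}`; theorems only

statement-level skeleton of published theorems with citation tags; proofs where landed; nothing here is a claim about the Yang–Mills mass gap

PDF held: `paper:balaban1982-cmp85-higgs23-i` (journal page = PDF page + 602); p. 617 [PDF 15] re-read this session in the materialised
text `~/.lit/texts/paper-balaban1982-cmp85-higgs23-i/p0015.txt`: *"The fields A′_j defining the components of (3.33) are independent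
Gaussian random variables with the covariances C^{(j),L^jε}."*

CITATION HEADER (lean-in-tree rule).  lit-balaban typed skeleton (HOME `run/shared/lean/pub/lit-balaban/`), unit `lit-balaban-r14` gen 25
(B1 fold owner `literature-prover-lit-balaban-r14-g25-0`; TAKING #3 line HOME/STATUS.md, free-target protocol G.5-34 (d)).  SKELETON rows
**B1.Eq3.24** / **B1.Eq3.59** (owner r12; cells only, no head change).  The chain for LEAF (b) of (3.24)/(3.59) in the tree:
`B1Eq324WeightedCumulantLeaf` (leaf (b) ⇐ tail `⟨1−χ⟩` + `L²(μ)`-moment bounds) ← `B1Eq324GaussianMomentLeaf` (moment bounds ⇐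
`V` a polynomial in variables with `HasSubgaussianMGF`) ← THIS FILE (the tree's fluctuation variables HAVE `HasSubgaussianMGF`, from the
exact m.g.f. identities of r14's `B1Eq324SmallFieldLeaf` §2/§3: `integral_exp_mul_apply_fluctMeasure` `∫e^{sA′_b}dμ = e^{s²·bondVar b/2}`,
`integral_exp_mul_apply_condGauss` `∫e^{sφ′(y)_i}dμ = e^{s²·siteVar y i/2}` — themselves the typer's `integral_exp_siteInner_fluctMeasure` /
`integral_exp_siteInner_condGauss` at delta test fields).  USED BY NAME, NOTHING RESTATED.  A separate small file rather than a v1.2 of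
`B1Eq324SmallFieldLeaf` so as not to invalidate that module's freshly built olean under its pending importers.

WHAT IS PROVED (0 `sorry`, standard axioms).  `hasSubgaussianMGF_of_mgf_eq` — an exact centred Gaussian m.g.f. `∫e^{sX}dμ = e^{s²c/2}`
(all `s`) gives `HasSubgaussianMGF X c⁺ μ` (`c⁺ = Real.toNNReal c`); `hasSubgaussianMGF_of_mgf_eq_of_le` — the same with any parameter
`σ² ≥ c`; **`hasSubgaussianMGF_apply_fluctMeasure`** / `…_of_le` (bond variable `A′_b`, parameter `(bondVar b)⁺` resp. any
`σ² ≥ bondVar b`, e.g. `B1Eq324SmallFieldLeaf.bondVar_le_of_ineq233_lower` from print's (2.33) lower half);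
**`hasSubgaussianMGF_fieldOfCrd_apply`** / `…_of_le` (component `φ′(y)_i` in the tree's coordinates, parameter `(siteVar y i)⁺` resp. `σ²`);
§4 `hasSubgaussianMGF_fst_prod` / `hasSubgaussianMGF_snd_prod` — both stay sub-Gaussian, same parameter, under the PRODUCT with a probability
measure (the product law `dμ(A′)dμ(φ′)` of (3.24)/(3.56); `B1Eq324GaussianMomentLeaf.poly` wants one measure for all its variables), and
`one_sub_integral_prod_mul_le` — the tail of the product cut-off `1 − ⟨χ(A′)χ(φ′)⟩ ≤ (1 − ⟨χ(A′)⟩) + (1 − ⟨χ(φ′)⟩)` (inputs `hτ` ∕ `hZ` of leaf (b)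
for the product law from the one-factor tails).
HONEST SCOPE.  Only the sub-Gaussian property of single linear functionals is recorded (what `B1Eq324GaussianMomentLeaf.poly` consumes,
variable by variable); independence / joint Gaussianity is not used there and not restated here.  Rows keep their heads.  NOT summit
progress; NOT Clay.
-/

open _root_.MeasureTheory _root_.ProbabilityTheory

namespace Literature.MathematicalPhysics.QuantumFieldTheory.Balaban1983to89.B1Eq324FluctuationSubgaussian

open HiggsFluctMeasure (fluctMeasure)
open HiggsCondGauss228 (condGauss fieldOfCrd inSet)
open B2Eq228Conditioning (In)
open B1Eq324SmallFieldLeaf (bondVar siteVar integral_exp_mul_apply_fluctMeasure integral_exp_mul_apply_condGauss)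

noncomputable section

/-! ## §1 Generic: an exact (or dominated) centred Gaussian m.g.f. is sub-Gaussian -/

section Generic

variable {Ω : Type*} [MeasurableSpace Ω] {μ : Measure Ω} {X : Ω → ℝ} {c : ℝ}

/-- An exact centred Gaussian m.g.f. `∫e^{sX}dμ = e^{s²c/2}` (all `s`) makes `X` sub-Gaussian with parameter `c⁺ = max c 0` in
Mathlib's sense: `e^{tX}` is integrable (its integral is non-zero) and `mgf X μ t ≤ e^{c⁺t²/2}`. [cite: Balaban1982Higgs1, (3.24) p.616] -/
theorem hasSubgaussianMGF_of_mgf_eq (hmgf : ∀ s : ℝ, ∫ ω, Real.exp (s * X ω) ∂μ = Real.exp (s ^ 2 * c / 2)) :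
    HasSubgaussianMGF X c.toNNReal μ := by
  refine ⟨fun t => Integrable.of_integral_ne_zero ?_, fun t => ?_⟩
  · rw [hmgf t]; exact (Real.exp_pos _).ne'
  · rw [mgf, hmgf t]
    refine Real.exp_le_exp.2 ?_
    have h1 : c ≤ (c.toNNReal : ℝ) := Real.le_coe_toNNReal c
    have h2 : t ^ 2 * c ≤ (c.toNNReal : ℝ) * t ^ 2 := by nlinarith [sq_nonneg t]
    linarith

/-- … and with any larger parameter: `c ≤ σ²` gives `HasSubgaussianMGF X (σ²)⁺ μ` (uniform parameters over a family of variables).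
[cite: Balaban1982Higgs1, (3.24) p.616] -/
theorem hasSubgaussianMGF_of_mgf_eq_of_le (hmgf : ∀ s : ℝ, ∫ ω, Real.exp (s * X ω) ∂μ = Real.exp (s ^ 2 * c / 2)) {σsq : ℝ}
    (hσ : c ≤ σsq) : HasSubgaussianMGF X σsq.toNNReal μ := by
  refine ⟨fun t => Integrable.of_integral_ne_zero ?_, fun t => ?_⟩
  · rw [hmgf t]; exact (Real.exp_pos _).ne'
  · rw [mgf, hmgf t]
    refine Real.exp_le_exp.2 ?_
    have h1 : σsq ≤ (σsq.toNNReal : ℝ) := Real.le_coe_toNNReal σsq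
    have h2 : t ^ 2 * c ≤ (σsq.toNNReal : ℝ) * t ^ 2 := by nlinarith [sq_nonneg t]
    linarith

end Generic

/-! ## §2 The bond variables `A′_b` under `dμ_{C^{(j),L^jε}}` -/

section Vector

variable {P : HiggsLattice.Params} {j : ℕ}

/-- **THE BOND VARIABLE `A′_b` IS SUB-GAUSSIAN with parameter `(bondVar b)⁺`** under the fluctuation measure `dμ_{C^{(j),L^jε}}`
(`HiggsFluctMeasure.fluctMeasure`; `μ₀² > 0`, `a > 0`, `L > 1`, `j ≤ K`) — p. 617 *"independent Gaussian random variables with the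
covariances C^{(j),L^jε}"*, via `B1Eq324SmallFieldLeaf.integral_exp_mul_apply_fluctMeasure`. [cite: Balaban1982Higgs1, (3.24) p.616] -/
theorem hasSubgaussianMGF_apply_fluctMeasure {msq a : ℝ} (hmsq : 0 < msq) (ha : 0 < a) (hL : 1 < (P.L : ℝ)) (hj : j ≤ P.K)
    (b : HiggsLattice.PBond P j) :
    HasSubgaussianMGF (fun A : HiggsLattice.VecField P j => A b) (bondVar P msq a j b).toNNReal (fluctMeasure P msq a j) :=
  hasSubgaussianMGF_of_mgf_eq (integral_exp_mul_apply_fluctMeasure hmsq ha hL hj b)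

/-- … with a UNIFORM parameter `σ² ≥ bondVar b` (e.g. `B1Eq324SmallFieldLeaf.bondVar_le_of_ineq233_lower`, from print's (2.33) lower
half): `HasSubgaussianMGF (A′_b) (σ²)⁺`. [cite: Balaban1982Higgs1, (3.24) p.616] -/
theorem hasSubgaussianMGF_apply_fluctMeasure_of_le {msq a : ℝ} (hmsq : 0 < msq) (ha : 0 < a) (hL : 1 < (P.L : ℝ))
    (hj : j ≤ P.K) {σsq : ℝ} (b : HiggsLattice.PBond P j) (hσ : bondVar P msq a j b ≤ σsq) :
    HasSubgaussianMGF (fun A : HiggsLattice.VecField P j => A b) σsq.toNNReal (fluctMeasure P msq a j) :=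
  hasSubgaussianMGF_of_mgf_eq_of_le (integral_exp_mul_apply_fluctMeasure hmsq ha hL hj b) hσ

end Vector

/-! ## §3 The components `φ′(y)_i` under `dμ_{C^{(k)}_Λ(Ω,A)}` -/

section Scalar

variable {P : HiggsLattice.Params} {N k : ℕ} (C : HiggsLattice.ChargeData N) (Ω : Finset (HiggsLattice.Site P 0)) (A : HiggsLattice.VecField P 0)

/-- **THE COMPONENT `φ′(y)_i` IS SUB-GAUSSIAN with parameter `(siteVar y i)⁺`** under the conditional Gaussian measure
`dμ_{C^{(k)}_Λ(Ω,A)}` in the tree's coordinates (`HiggsCondGauss228.condGauss`; `m² > 0`, `a > 0`, `L > 1`, `k ≤ K`), via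
`B1Eq324SmallFieldLeaf.integral_exp_mul_apply_condGauss`. [cite: Balaban1982Higgs1, (3.24) p.616] -/
theorem hasSubgaussianMGF_fieldOfCrd_apply {msq a : ℝ} (hmsq : 0 < msq) (ha : 0 < a) (hL : 1 < (P.L : ℝ)) (hk : k ≤ P.K)
    (Λ : Finset (HiggsLattice.Site P k)) (y : HiggsLattice.Site P k) (i : Fin N) :
    HasSubgaussianMGF (fun x : In (inSet (P := P) N Λ) → ℝ => fieldOfCrd Λ x y i)
      (siteVar P C Ω A msq a k Λ y i).toNNReal (condGauss C Ω A msq a k Λ) :=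
  hasSubgaussianMGF_of_mgf_eq (integral_exp_mul_apply_condGauss C Ω A hmsq ha hL hk Λ y i)

/-- … with a UNIFORM parameter `σ² ≥ siteVar y i` (e.g. `B1Eq324SmallFieldLeaf.siteVar_le_of_ineq233_lower`):
`HasSubgaussianMGF (φ′(y)_i) (σ²)⁺`. [cite: Balaban1982Higgs1, (3.24) p.616] -/
theorem hasSubgaussianMGF_fieldOfCrd_apply_of_le {msq a : ℝ} (hmsq : 0 < msq) (ha : 0 < a) (hL : 1 < (P.L : ℝ))
    (hk : k ≤ P.K) (Λ : Finset (HiggsLattice.Site P k)) {σsq : ℝ} (y : HiggsLattice.Site P k) (i : Fin N)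
    (hσ : siteVar P C Ω A msq a k Λ y i ≤ σsq) :
    HasSubgaussianMGF (fun x : In (inSet (P := P) N Λ) → ℝ => fieldOfCrd Λ x y i) σsq.toNNReal
      (condGauss C Ω A msq a k Λ) :=
  hasSubgaussianMGF_of_mgf_eq_of_le (integral_exp_mul_apply_condGauss C Ω A hmsq ha hL hk Λ y i) hσ

end Scalar

/-! ## §4 Under a product with another probability measure (the product law `dμ_{C^{(k)}}(A′)dμ_{C^{(k)}(B^{(k+1)})}(φ′)` of (3.24)/(3.56)) -/

section Product

variable {Ω₁ Ω₂ : Type*} [MeasurableSpace Ω₁] [MeasurableSpace Ω₂] {μ₁ : Measure Ω₁} {μ₂ : Measure Ω₂} {c : NNReal}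

/-- A sub-Gaussian variable of the FIRST factor stays sub-Gaussian, same parameter, under the product with a probability measure
(Fubini: the m.g.f. is unchanged; Mathlib's `HasSubgaussianMGF.of_map` with `Measure.map_fst_prod`) — so the bond variables `A′_b`
are sub-Gaussian under the product law `dμ(A′)dμ(φ′)` of (3.24)/(3.56), as `B1Eq324GaussianMomentLeaf.poly` requires (one measure
for all variables). [cite: Balaban1982Higgs1, (3.24) p.616] -/
theorem hasSubgaussianMGF_fst_prod [SFinite μ₁] [IsProbabilityMeasure μ₂] {X : Ω₁ → ℝ} (h : HasSubgaussianMGF X c μ₁) :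
    HasSubgaussianMGF (fun p : Ω₁ × Ω₂ => X p.1) c (μ₁.prod μ₂) := by
  refine HasSubgaussianMGF.of_map measurable_fst.aemeasurable ?_
  rwa [Measure.map_fst_prod, measure_univ, one_smul]

/-- … and a sub-Gaussian variable of the SECOND factor (the components `φ′(y)_i`) likewise (`Measure.map_snd_prod`).
[cite: Balaban1982Higgs1, (3.24) p.616] -/
theorem hasSubgaussianMGF_snd_prod [IsProbabilityMeasure μ₁] [SFinite μ₂] {Y : Ω₂ → ℝ} (h : HasSubgaussianMGF Y c μ₂) :
    HasSubgaussianMGF (fun p : Ω₁ × Ω₂ => Y p.2) c (μ₁.prod μ₂) := by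
  refine HasSubgaussianMGF.of_map measurable_snd.aemeasurable ?_
  rwa [Measure.map_snd_prod, measure_univ, one_smul]

/-- THE TAIL OF A PRODUCT CUT-OFF under a product of probability measures: for `0 ≤ f ≤ 1` on the first factor and `0 ≤ g ≤ 1` on the
second, `1 − ∫ f(p₁)g(p₂) d(μ₁⊗μ₂) = 1 − ⟨f⟩⟨g⟩ ≤ (1 − ⟨f⟩) + (1 − ⟨g⟩)` (`MeasureTheory.integral_prod_mul`) — the tail `⟨1 − χ(A′)χ(φ′)⟩`
of the product characteristic function of (3.24)/(3.56) from the two one-factor tails of `B1Eq324SmallFieldLeaf` (the input `hτ` ∕ `hZ`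
of `B1Eq324WeightedCumulantLeaf` for the product law). [cite: Balaban1982Higgs1, (3.56) p.622] -/
theorem one_sub_integral_prod_mul_le [IsProbabilityMeasure μ₁] [IsProbabilityMeasure μ₂] {f : Ω₁ → ℝ} {g : Ω₂ → ℝ}
    (hf0 : ∀ x, 0 ≤ f x) (hf1 : ∀ x, f x ≤ 1) (hg0 : ∀ y, 0 ≤ g y) (hg1 : ∀ y, g y ≤ 1)
    (hfm : AEStronglyMeasurable f μ₁) (hgm : AEStronglyMeasurable g μ₂) :
    1 - ∫ p, f p.1 * g p.2 ∂(μ₁.prod μ₂) ≤ (1 - ∫ x, f x ∂μ₁) + (1 - ∫ y, g y ∂μ₂) := by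
  rw [integral_prod_mul f g]
  have hf_int : Integrable f μ₁ := (integrable_const (1 : ℝ)).mono' hfm
    (ae_of_all _ fun x => by rw [Real.norm_eq_abs, abs_of_nonneg (hf0 x)]; exact hf1 x)
  have hg_int : Integrable g μ₂ := (integrable_const (1 : ℝ)).mono' hgm
    (ae_of_all _ fun y => by rw [Real.norm_eq_abs, abs_of_nonneg (hg0 y)]; exact hg1 y)
  have ha0 : 0 ≤ ∫ x, f x ∂μ₁ := integral_nonneg hf0
  have ha1 : ∫ x, f x ∂μ₁ ≤ 1 := by
    calc ∫ x, f x ∂μ₁ ≤ ∫ _, (1 : ℝ) ∂μ₁ := integral_mono hf_int (integrable_const 1) hf1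
      _ = 1 := by simp
  have hb0 : 0 ≤ ∫ y, g y ∂μ₂ := integral_nonneg hg0
  have hb1 : ∫ y, g y ∂μ₂ ≤ 1 := by
    calc ∫ y, g y ∂μ₂ ≤ ∫ _, (1 : ℝ) ∂μ₂ := integral_mono hg_int (integrable_const 1) hg1
      _ = 1 := by simp
  nlinarith [mul_nonneg (sub_nonneg.2 ha1) (sub_nonneg.2 hb1)]

end Product

end

end Literature.MathematicalPhysics.QuantumFieldTheory.Balaban1983to89.B1Eq324FluctuationSubgaussian
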